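import Literature.Analysis.UnboundedOperators.LinearizedBoltzmannSelfAdjoint
import HarnessLib

/-!
# The linearised hard-sphere operator: action on functions of temperate growth, non-positivity

Sibling proof file of `LinearizedBoltzmann.lean` (the last step towards the discharge of
`exists_isSelfAdjoint_hasCore`, CIP 1994 §7.2 Thm 7.2.1). For the self-adjoint operator
`A = -ν + K` of `LinearizedBoltzmannOperator` / `LinearizedBoltzmannSelfAdjoint` we prove that it
*is* the linearised hard-sphere operator of the statement file:

* `hardSphereLinearizedOp_eq_kernel_sub` — Grad's splitting at function level: for `g` of
  temperate growth and every `v`,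
  `L g (v) = ∫∫ B (g(v') + g(v_*') - g(v_*)) dω dM(v_*) - ν(v) g(v)` (CIP 1994 §7.2 (2.14));
* `linearizedKernelForm_eq_integral` — Fubini: `⟪h, K g⟫_M = ∫ h(v) (∫∫ B (g' + g_*' - g_*)) dM`
  for `h ∈ L²(M dv)` and `g` of temperate growth, whence
  `gainLossOp_toLp` — `K [g] = [∫∫ B (g' + g_*' - g_*) dω dM_*]`, and
  `linearizedHardSpherePMap_toLp` / `coeFn_linearizedHardSpherePMap_of_ae_eq` — **`A [g] = [L g]`**:
  `A` acts on the temperate-growth classes as `hardSphereLinearizedOp`;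
* `isPositive_neg_linearizedHardSpherePMap` — **`-A ≥ 0`** (CIP 1994 §7.1 (7.1.10) `(h, Lh) ≤ 0`,
  proved on temperate functions in `LinearizedBoltzmannSymmetryProofs`, extended to `dom A` by the
  graph-norm approximation `exists_schwartz_graph_approx`).

## References

* C. Cercignani, R. Illner, M. Pulvirenti, *The Mathematical Theory of Dilute Gases*, Springer
  (1994), §7.1 (7.1.6)–(7.1.10) pp. 191–193, §7.2 (2.13)–(2.14) and Thm 7.2.1 p. 197.
-/

open MeasureTheory Metric Real Set Filter Topology ProbabilityTheory Module
open scoped InnerProductSpace ENNReal SchwartzMap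

namespace Literature.Analysis.UnboundedOperators

noncomputable section

open Literature.MathematicalPhysics.KineticTheory (collide sphereMeasure hardSphereKernel)
open Literature.Analysis.FluidPDE

variable {E : Type*} [NormedAddCommGroup E] [InnerProductSpace ℝ E] [FiniteDimensional ℝ E]
  [MeasurableSpace E] [BorelSpace E]

/-! ### Parametric integrals over the sphere with polynomial bounds -/

section Parametric

/-- A continuous integrand on `E × S^{d-1}` with `|Φ(w, ω)| ≤ C (1 + |w|)^m` has integrable
sections over the (finite) sphere measure. [folklore] -/
theorem integrable_sphere_section {Φ : E × sphere (0 : E) 1 → ℝ} (hΦ : Continuous Φ) {C : ℝ}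
    {m : ℕ} (hle : ∀ w ω, |Φ (w, ω)| ≤ C * (1 + ‖w‖) ^ m) (w : E) :
    Integrable (fun ω => Φ (w, ω)) (sphereMeasure : Measure (sphere (0 : E) 1)) := by
  haveI := isFiniteMeasure_sphereMeasure (E := E)
  exact (integrable_const (C * (1 + ‖w‖) ^ m)).mono'
    (hΦ.comp (Continuous.prodMk_right w)).aestronglyMeasurable
    (Eventually.of_forall fun ω => by rw [Real.norm_eq_abs]; exact hle w ω)

/-- … and its partial integral `w ↦ ∫ Φ(w, ω) dω` is `M dv`-integrable (Gaussian moments).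
[folklore] -/
theorem integrable_integral_sphere {Φ : E × sphere (0 : E) 1 → ℝ} (hΦ : Continuous Φ) {C : ℝ}
    {m : ℕ} (hle : ∀ w ω, |Φ (w, ω)| ≤ C * (1 + ‖w‖) ^ m) :
    Integrable (fun w => ∫ ω, Φ (w, ω) ∂(sphereMeasure : Measure (sphere (0 : E) 1)))
      (stdGaussian E) := by
  haveI := isFiniteMeasure_sphereMeasure (E := E)
  set S : ℝ := (sphereMeasure : Measure (sphere (0 : E) 1)).real univ with hS
  have hsm : StronglyMeasurable fun w =>
      ∫ ω, Φ (w, ω) ∂(sphereMeasure : Measure (sphere (0 : E) 1)) :=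
    hΦ.stronglyMeasurable.integral_prod_right'
  refine ((integrable_one_add_norm_pow_stdGaussian m).const_mul (S * |C|)).mono'
    hsm.aestronglyMeasurable (Eventually.of_forall fun w => ?_)
  have hbound : ∀ ω : sphere (0 : E) 1, ‖Φ (w, ω)‖ ≤ |C| * (1 + ‖w‖) ^ m := fun ω => by
    rw [Real.norm_eq_abs]
    exact (hle w ω).trans (mul_le_mul_of_nonneg_right (le_abs_self C) (by positivity))
  calc ‖∫ ω, Φ (w, ω) ∂(sphereMeasure : Measure (sphere (0 : E) 1))‖
      ≤ ∫ _ : sphere (0 : E) 1, |C| * (1 + ‖w‖) ^ m ∂sphereMeasure :=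
        norm_integral_le_of_norm_le (integrable_const _) (Eventually.of_forall hbound)
    _ = S * |C| * (1 + ‖w‖) ^ m := by rw [integral_const, smul_eq_mul, hS]; ring

/-- … with the bound `|∫ Φ(w, ω) dω| ≤ σ(S) |C| (1 + |w|)^m`. [folklore] -/
theorem abs_integral_sphere_le {Φ : E × sphere (0 : E) 1 → ℝ} {C : ℝ} {m : ℕ}
    (hle : ∀ w ω, |Φ (w, ω)| ≤ C * (1 + ‖w‖) ^ m) (w : E) :
    |∫ ω, Φ (w, ω) ∂(sphereMeasure : Measure (sphere (0 : E) 1))| ≤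
      (sphereMeasure : Measure (sphere (0 : E) 1)).real univ * |C| * (1 + ‖w‖) ^ m := by
  haveI := isFiniteMeasure_sphereMeasure (E := E)
  have hbound : ∀ ω : sphere (0 : E) 1, ‖Φ (w, ω)‖ ≤ |C| * (1 + ‖w‖) ^ m := fun ω => by
    rw [Real.norm_eq_abs]
    exact (hle w ω).trans (mul_le_mul_of_nonneg_right (le_abs_self C) (by positivity))
  rw [← Real.norm_eq_abs]
  calc ‖∫ ω, Φ (w, ω) ∂(sphereMeasure : Measure (sphere (0 : E) 1))‖
      ≤ ∫ _ : sphere (0 : E) 1, |C| * (1 + ‖w‖) ^ m ∂sphereMeasure :=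
        norm_integral_le_of_norm_le (integrable_const _) (Eventually.of_forall hbound)
    _ = _ := by rw [integral_const, smul_eq_mul, Measure.real]; ring

end Parametric

/-! ### Grad's splitting at function level -/

section Splitting

omit [FiniteDimensional ℝ E] [MeasurableSpace E] [BorelSpace E] in
/-- The kernel-part integrand `B (g(v') + g(v_*') - g(v_*))` of a function of temperate growth is
continuous on `E × E × S^{d-1}` and polynomially bounded:
`|B (g' + g_*' - g_*)| ≤ 3 C ((1 + |v|)(1 + |v_*|))^{k+1}` when `|g| ≤ C (1 + |·|)^k`. [folklore] -/
theorem continuous_and_abs_kernelIntegrand_le {g : E → ℝ} (hg : g.HasTemperateGrowth) {k : ℕ} {C : ℝ}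
    (hC0 : 0 ≤ C) (hC : ∀ u, |g u| ≤ C * (1 + ‖u‖) ^ k) :
    Continuous (fun q : (E × E) × sphere (0 : E) 1 => hardSphereKernel q.1 q.2 *
        (g (collide q.2 q.1).1 + g (collide q.2 q.1).2 - g q.1.2)) ∧
      ∀ q : (E × E) × sphere (0 : E) 1, |hardSphereKernel q.1 q.2 *
        (g (collide q.2 q.1).1 + g (collide q.2 q.1).2 - g q.1.2)| ≤
          3 * C * ((1 + ‖q.1.1‖) * (1 + ‖q.1.2‖)) ^ (k + 1) := by
  have hgc : Continuous g := hg.1.continuous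
  refine ⟨by unfold hardSphereKernel; fun_prop, fun q => ?_⟩
  obtain ⟨⟨v, w⟩, ω⟩ := q
  set X : ℝ := (1 + ‖v‖) * (1 + ‖w‖) with hX
  have hX1 : 1 ≤ X := by rw [hX]; nlinarith [norm_nonneg v, norm_nonneg w]
  have hB : hardSphereKernel (v, w) ω ≤ X := by
    refine (hardSphereKernel_le_abs_inner_add_norm v w ω).trans ?_
    rw [hX]; nlinarith [abs_inner_sphere_le v ω, mul_nonneg (norm_nonneg v) (norm_nonneg w)]
  have hgX : ∀ u : E, 1 + ‖u‖ ≤ X → |g u| ≤ C * X ^ k := fun u hu =>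
    (hC u).trans (mul_le_mul_of_nonneg_left (pow_le_pow_left₀ (by positivity) hu k) hC0)
  have h1 := hgX _ (one_add_norm_collide_fst_le ω (v, w))
  have h2 := hgX _ (one_add_norm_collide_snd_le ω (v, w))
  have h3 := hgX _ (one_add_norm_snd_le (v, w))
  dsimp only
  rw [abs_mul, abs_of_nonneg (show 0 ≤ hardSphereKernel (v, w) ω from le_max_right _ _), pow_succ]
  have hsum : |g (collide ω (v, w)).1 + g (collide ω (v, w)).2 - g w| ≤ 3 * (C * X ^ k) := by
    refine (abs_sub _ _).trans ((add_le_add (abs_add_le _ _) le_rfl).trans ?_)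
    linarith
  calc hardSphereKernel (v, w) ω * |g (collide ω (v, w)).1 + g (collide ω (v, w)).2 - g w|
      ≤ X * (3 * (C * X ^ k)) := mul_le_mul hB hsum (abs_nonneg _) (by positivity)
    _ = 3 * C * (X ^ k * X) := by ring

/-- **Grad's splitting of the linearised hard-sphere operator at function level**
(CIP 1994 §7.2 (2.14), weighted picture): for `g` of temperate growth and every `v`,
`L g (v) = ∫∫ B (g(v') + g(v_*') - g(v_*)) dω dM(v_*) - ν(v) g(v)`, all integrals being absolutely
convergent. [cite: CIPDiluteGases1994, §7.2 (2.14)] -/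
theorem hardSphereLinearizedOp_eq_kernel_sub {g : E → ℝ} (hg : g.HasTemperateGrowth) (v : E) :
    hardSphereLinearizedOp g v =
      (∫ w, ∫ ω, hardSphereKernel (v, w) ω *
          (g (collide ω (v, w)).1 + g (collide ω (v, w)).2 - g w) ∂sphereMeasure ∂stdGaussian E) -
        collisionFrequency v * g v := by
  obtain ⟨k, C, hC0, hC⟩ := exists_abs_le_of_hasTemperateGrowth hg
  obtain ⟨hcont, hbd⟩ := continuous_and_abs_kernelIntegrand_le hg hC0 hC
  -- the sections at `v`
  set Φ₁ : E × sphere (0 : E) 1 → ℝ := fun p => hardSphereKernel (v, p.1) p.2 *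
    (g (collide p.2 (v, p.1)).1 + g (collide p.2 (v, p.1)).2 - g p.1) with hΦ₁
  set Φ₀ : E × sphere (0 : E) 1 → ℝ := fun p => hardSphereKernel (v, p.1) p.2 with hΦ₀
  have hι : Continuous fun p : E × sphere (0 : E) 1 => (((v, p.1), p.2) : (E × E) × sphere (0 : E) 1) := by
    fun_prop
  have hΦ₁c : Continuous Φ₁ := hcont.comp hι
  have hΦ₀c : Continuous Φ₀ := by unfold Φ₀ hardSphereKernel; fun_prop
  have hΦ₁b : ∀ w ω, |Φ₁ (w, ω)| ≤ (3 * C * (1 + ‖v‖) ^ (k + 1)) * (1 + ‖w‖) ^ (k + 1) := by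
    intro w ω
    have := hbd ((v, w), ω)
    rw [mul_pow] at this
    simpa only [hΦ₁, mul_assoc] using this
  have hΦ₀b : ∀ w ω, |Φ₀ (w, ω)| ≤ (1 + ‖v‖) * (1 + ‖w‖) ^ 1 := by
    intro w ω
    show |hardSphereKernel (v, w) ω| ≤ (1 + ‖v‖) * (1 + ‖w‖) ^ 1
    rw [pow_one, abs_of_nonneg (show 0 ≤ hardSphereKernel (v, w) ω from le_max_right _ _)]
    refine (hardSphereKernel_le_abs_inner_add_norm v w ω).trans ?_
    nlinarith [abs_inner_sphere_le v ω, mul_nonneg (norm_nonneg v) (norm_nonneg w)]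
  have hinner : ∀ w, ∫ ω, hardSphereKernel (v, w) ω * (g (collide ω (v, w)).1 +
      g (collide ω (v, w)).2 - g v - g w) ∂sphereMeasure =
      (∫ ω, Φ₁ (w, ω) ∂sphereMeasure) - g v * ∫ ω, Φ₀ (w, ω) ∂sphereMeasure := by
    intro w
    rw [← integral_const_mul, ← integral_sub (integrable_sphere_section hΦ₁c hΦ₁b w)
      ((integrable_sphere_section hΦ₀c hΦ₀b w).const_mul _)]
    refine integral_congr_ae (Eventually.of_forall fun ω => ?_)
    simp only [hΦ₁, hΦ₀]
    ring
  unfold hardSphereLinearizedOp linearizedCollisionOp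
  rw [integral_congr_ae (Eventually.of_forall hinner), integral_sub
    (integrable_integral_sphere hΦ₁c hΦ₁b) ((integrable_integral_sphere hΦ₀c hΦ₀b).const_mul _),
    integral_const_mul, collisionFrequency, mul_comm (g v)]

/-- The kernel part `v ↦ ∫∫ B (g' + g_*' - g_*) dω dM_*` of a function of temperate growth is
(strongly) measurable … [folklore] -/
theorem stronglyMeasurable_kernelAction {g : E → ℝ} (hg : g.HasTemperateGrowth) :
    StronglyMeasurable fun v : E => ∫ w, ∫ ω, hardSphereKernel (v, w) ω *
      (g (collide ω (v, w)).1 + g (collide ω (v, w)).2 - g w) ∂sphereMeasure ∂stdGaussian E := by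
  obtain ⟨k, C, hC0, hC⟩ := exists_abs_le_of_hasTemperateGrowth hg
  obtain ⟨hcont, -⟩ := continuous_and_abs_kernelIntegrand_le hg hC0 hC
  have h1 : StronglyMeasurable fun p : E × E => ∫ ω, hardSphereKernel p ω *
      (g (collide ω p).1 + g (collide ω p).2 - g p.2) ∂(sphereMeasure : Measure (sphere (0 : E) 1)) :=
    hcont.stronglyMeasurable.integral_prod_right'
  exact h1.integral_prod_right' (ν := stdGaussian E)

/-- … and polynomially bounded, `|∫∫ B (g' + g_*' - g_*)| ≤ C' (1 + |v|)^{k+1}`, hence in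
`L²(M dv)`. [folklore] -/
theorem memLp_two_kernelAction {g : E → ℝ} (hg : g.HasTemperateGrowth) :
    MemLp (fun v : E => ∫ w, ∫ ω, hardSphereKernel (v, w) ω *
      (g (collide ω (v, w)).1 + g (collide ω (v, w)).2 - g w) ∂sphereMeasure ∂stdGaussian E)
      2 (stdGaussian E) := by
  haveI := isFiniteMeasure_sphereMeasure (E := E)
  obtain ⟨k, C, hC0, hC⟩ := exists_abs_le_of_hasTemperateGrowth hg
  obtain ⟨-, hbd⟩ := continuous_and_abs_kernelIntegrand_le hg hC0 hC
  set S : ℝ := (sphereMeasure : Measure (sphere (0 : E) 1)).real univ with hS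
  set m : ℝ := ∫ w, (1 + ‖w‖) ^ (k + 1) ∂stdGaussian E with hm
  refine memLp_two_of_abs_le_pow (stronglyMeasurable_kernelAction hg).aestronglyMeasurable
    (C := S * |3 * C| * m) (m := k + 1) fun v => ?_
  have hrow : ∀ w, |∫ ω, hardSphereKernel (v, w) ω * (g (collide ω (v, w)).1 +
      g (collide ω (v, w)).2 - g w) ∂sphereMeasure| ≤
      S * |3 * C * (1 + ‖v‖) ^ (k + 1)| * (1 + ‖w‖) ^ (k + 1) := by
    intro w
    refine abs_integral_sphere_le (Φ := fun p : E × sphere (0 : E) 1 => hardSphereKernel (v, p.1) p.2 *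
      (g (collide p.2 (v, p.1)).1 + g (collide p.2 (v, p.1)).2 - g p.1)) (fun w ω => ?_) w
    have := hbd ((v, w), ω)
    rw [mul_pow] at this
    simpa only [mul_assoc] using this
  rw [← Real.norm_eq_abs]
  calc ‖∫ w, ∫ ω, hardSphereKernel (v, w) ω * (g (collide ω (v, w)).1 +
        g (collide ω (v, w)).2 - g w) ∂sphereMeasure ∂stdGaussian E‖
      ≤ ∫ w, S * |3 * C * (1 + ‖v‖) ^ (k + 1)| * (1 + ‖w‖) ^ (k + 1) ∂stdGaussian E :=
        norm_integral_le_of_norm_le ((integrable_one_add_norm_pow_stdGaussian (k + 1)).const_mul _)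
          (Eventually.of_forall fun w => by rw [Real.norm_eq_abs]; exact hrow w)
    _ = S * |3 * C| * m * (1 + ‖v‖) ^ (k + 1) := by
        rw [integral_const_mul, hm, abs_mul, abs_of_nonneg (by positivity : (0 : ℝ) ≤ (1 + ‖v‖) ^ (k + 1))]
        ring

end Splitting

/-! ### The action of `K` and `A` on temperate-growth classes -/

section Action

/-- **Fubini for `⟪h, K g⟫`**: for `h ∈ L²(M dv)` and `g` of temperate growth,
`⟪h, K g⟫_M = ∫ h(v) (∫∫ B (g(v') + g(v_*') - g(v_*)) dω dM(v_*)) dM(v)` (the three kernel forms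
are absolutely convergent, `M dv = M(v) dv`, Fubini). [folklore] -/
theorem linearizedKernelForm_eq_integral (hE : 2 ≤ finrank ℝ E) {g : E → ℝ}
    (hg : g.HasTemperateGrowth) {h : E → ℝ} (hh : MemLp h 2 (stdGaussian E)) :
    linearizedKernelForm h g = ∫ v, h v * (∫ w, ∫ ω, hardSphereKernel (v, w) ω *
      (g (collide ω (v, w)).1 + g (collide ω (v, w)).2 - g w) ∂sphereMeasure ∂stdGaussian E)
      ∂stdGaussian E := by
  have hgL : MemLp g 2 (stdGaussian E) := memLp_two_of_hasTemperateGrowth hg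
  have i1 := (integrable_and_abs_kernelForm_le quasiMeasurePreserving_gainVelFst
    gainFstRowConst_ne_top hh hgL (lintegral_enorm_kernelForm_gainVelFst_le hh.1 hgL.1)).1
  have i2 := (integrable_and_abs_kernelForm_le quasiMeasurePreserving_gainVelSnd
    (gainSndRowConst_ne_top hE) hh hgL (lintegral_enorm_kernelForm_gainVelSnd_le hE hh.1 hgL.1)).1
  have i3 := (integrable_and_abs_kernelForm_le quasiMeasurePreserving_lossVel
    lossRowConst_ne_top hh hgL (lintegral_enorm_kernelForm_lossVel_le hh.1 hgL.1)).1
  set Kint : (E × E) × sphere (0 : E) 1 → ℝ := fun q => collisionDensity q *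
    (h q.1.1 * (g (collide q.2 q.1).1 + g (collide q.2 q.1).2 - g q.1.2)) with hKint
  have hK : Integrable Kint (((volume : Measure E).prod volume).prod sphereMeasure) := by
    refine ((i1.add i2).sub i3).congr (Eventually.of_forall fun q => ?_)
    simp only [hKint, Pi.add_apply, Pi.sub_apply, gainVelFst_apply, gainVelSnd_apply, lossVel_apply]
    ring
  have hsum : linearizedKernelForm h g =
      ∫ q, Kint q ∂(((volume : Measure E).prod volume).prod sphereMeasure) := by
    have hadd : Integrable (fun q => collisionDensity q * (h q.1.1 * g (gainVelFst q)) +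
        collisionDensity q * (h q.1.1 * g (gainVelSnd q)))
        (((volume : Measure E).prod volume).prod sphereMeasure) := i1.add i2
    simp only [linearizedKernelForm, kernelForm]
    rw [← integral_add i1 i2, ← integral_sub hadd i3]
    refine integral_congr_ae (Eventually.of_forall fun q => ?_)
    simp only [hKint, gainVelFst_apply, gainVelSnd_apply, lossVel_apply]
    ring
  rw [hsum, integral_prod _ hK, integral_prod _ hK.integral_prod_left,
    integral_stdGaussian_eq_integral_mul_globalMaxwellian]
  refine integral_congr_ae (Eventually.of_forall fun v => ?_)
  dsimp only
  rw [integral_stdGaussian_eq_integral_mul_globalMaxwellian, ← integral_const_mul,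
    ← integral_const_mul]
  refine integral_congr_ae (Eventually.of_forall fun w => ?_)
  dsimp only
  rw [← integral_const_mul, ← integral_const_mul, ← integral_const_mul]
  refine integral_congr_ae (Eventually.of_forall fun ω => ?_)
  simp only [hKint, collisionDensity]
  ring

/-- **`K` on temperate-growth classes**: `K [g] = [∫∫ B (g' + g_*' - g_*) dω dM_*]`. [folklore] -/
theorem gainLossOp_toLp (hE : 2 ≤ finrank ℝ E) {g : E → ℝ} (hg : g.HasTemperateGrowth) :
    gainLossOp hE ((memLp_two_of_hasTemperateGrowth hg).toLp g) =
      (memLp_two_kernelAction hg).toLp _ := by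
  refine ext_inner_right ℝ fun h => ?_
  rw [inner_gainLossOp, linearizedKernelForm_congr_ae EventuallyEq.rfl (MemLp.coeFn_toLp _),
    linearizedKernelForm_eq_integral hE hg (Lp.memLp h), L2.inner_def]
  refine integral_congr_ae ?_
  filter_upwards [MemLp.coeFn_toLp (memLp_two_kernelAction hg)] with v hv
  rw [hv]
  simp only [RCLike.inner_apply, conj_trivial, mul_comm]

/-- **`A` on temperate-growth classes is the linearised hard-sphere operator**: for `g` of
temperate growth, `A [g] = [L g]` a.e., i.e. `(A [g])(v) = hardSphereLinearizedOp g v` for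
`M dv`-a.e. `v` (CIP 1994 §7.2 (2.14): `L = K - ν` on the dense domain of (7.1.6)).
[cite: CIPDiluteGases1994, §7.2 (2.14)] -/
theorem coeFn_linearizedHardSpherePMap_toLp (hE : 2 ≤ finrank ℝ E) {g : E → ℝ}
    (hg : g.HasTemperateGrowth) :
    ((linearizedHardSpherePMap hE ((⟨(memLp_two_of_hasTemperateGrowth hg).toLp g,
        temperateSubmodule_le_linearizedDomain (toLp_mem_temperateSubmodule hg)⟩ :
        linearizedDomain (E := E))) : Lp ℝ 2 (stdGaussian E)) : E → ℝ) =ᵐ[stdGaussian E]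
      hardSphereLinearizedOp g := by
  rw [linearizedHardSpherePMap_apply]
  dsimp only
  rw [gainLossOp_toLp hE hg]
  filter_upwards [Lp.coeFn_add (-mulFrequency ⟨(memLp_two_of_hasTemperateGrowth hg).toLp g,
      temperateSubmodule_le_linearizedDomain (toLp_mem_temperateSubmodule hg)⟩)
      ((memLp_two_kernelAction hg).toLp _),
    Lp.coeFn_neg (mulFrequency ⟨(memLp_two_of_hasTemperateGrowth hg).toLp g,
      temperateSubmodule_le_linearizedDomain (toLp_mem_temperateSubmodule hg)⟩),
    coeFn_mulFrequency ⟨(memLp_two_of_hasTemperateGrowth hg).toLp g,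
      temperateSubmodule_le_linearizedDomain (toLp_mem_temperateSubmodule hg)⟩,
    MemLp.coeFn_toLp (memLp_two_of_hasTemperateGrowth hg),
    MemLp.coeFn_toLp (memLp_two_kernelAction hg)] with v h1 h2 h3 h4 h5
  rw [h1, Pi.add_apply, h2, Pi.neg_apply, h3, h4, h5, hardSphereLinearizedOp_eq_kernel_sub hg v]
  ring

/-- The same, for an arbitrary element of `dom A` a.e. equal to a function of temperate growth
(the form used in `exists_isSelfAdjoint_hasCore`). [folklore] -/
theorem coeFn_linearizedHardSpherePMap_of_ae_eq (hE : 2 ≤ finrank ℝ E)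
    (f : linearizedDomain (E := E)) {g : E → ℝ} (hg : g.HasTemperateGrowth)
    (hfg : ((f : Lp ℝ 2 (stdGaussian E)) : E → ℝ) =ᵐ[stdGaussian E] g) :
    ((linearizedHardSpherePMap hE f : Lp ℝ 2 (stdGaussian E)) : E → ℝ) =ᵐ[stdGaussian E]
      hardSphereLinearizedOp g := by
  have hfeq : (f : Lp ℝ 2 (stdGaussian E)) = (memLp_two_of_hasTemperateGrowth hg).toLp g :=
    Lp.ext (hfg.trans (MemLp.coeFn_toLp _).symm)
  have hf' : f = ⟨(memLp_two_of_hasTemperateGrowth hg).toLp g,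
      temperateSubmodule_le_linearizedDomain (toLp_mem_temperateSubmodule hg)⟩ :=
    Subtype.ext hfeq
  rw [hf']
  exact coeFn_linearizedHardSpherePMap_toLp hE hg

/-- `⟪[s], A [s]⟫ = ⟪s, L s⟫_M` for a Schwartz function `s`. [folklore] -/
theorem inner_linearizedHardSpherePMap_schwartz (hE : 2 ≤ finrank ℝ E) (s : 𝓢(E, ℝ)) :
    ⟪(s.toLp 2 (stdGaussian E) : Lp ℝ 2 (stdGaussian E)),
      linearizedHardSpherePMap hE ((⟨s.toLp 2 (stdGaussian E), schwartz_toLp_mem_linearizedDomain s⟩ :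
        linearizedDomain (E := E)))⟫_ℝ =
      maxwellianInner s (hardSphereLinearizedOp s) := by
  have h := coeFn_linearizedHardSpherePMap_of_ae_eq hE
    ((⟨s.toLp 2 (stdGaussian E), schwartz_toLp_mem_linearizedDomain s⟩ : linearizedDomain (E := E)))
    s.hasTemperateGrowth (s.coeFn_toLp 2 (stdGaussian E))
  rw [L2.inner_def, maxwellianInner]
  refine integral_congr_ae ?_
  filter_upwards [h, s.coeFn_toLp 2 (stdGaussian E)] with v hv hv'
  rw [hv, hv']
  simp only [RCLike.inner_apply, conj_trivial, mul_comm]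

end Action

/-! ### Non-positivity -/

section Positivity

/-- `⟪f, A f⟫ ≤ 0` on `dom A` (CIP 1994 §7.1 (7.1.10) `(h, Lh) ≤ 0` on temperate functions,
`maxwellianInner_hardSphereLinearizedOp_self_nonpos_holds`, extended to `dom A` by the graph-norm
approximation `exists_schwartz_graph_approx`). [cite: CIPDiluteGases1994, §7.1 (7.1.10)] -/
theorem inner_linearizedHardSpherePMap_self_nonpos (hE : 2 ≤ finrank ℝ E)
    (f : linearizedDomain (E := E)) :
    ⟪(f : Lp ℝ 2 (stdGaussian E)), linearizedHardSpherePMap hE f⟫_ℝ ≤ 0 := by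
  refine le_of_forall_pos_lt_add fun ε hε => ?_
  have hM0 : 0 < ‖linearizedHardSpherePMap hE f‖ + ‖(f : Lp ℝ 2 (stdGaussian E))‖ + 1 := by
    positivity
  set M : ℝ := ‖linearizedHardSpherePMap hE f‖ + ‖(f : Lp ℝ 2 (stdGaussian E))‖ + 1 with hM
  set δ : ℝ := min 1 (ε / (2 * M)) with hδ
  have hδ0 : 0 < δ := lt_min one_pos (div_pos hε (by positivity))
  have hδ1 : δ ≤ 1 := min_le_left _ _
  have hδM : δ * M ≤ ε / 2 := by
    have : δ ≤ ε / (2 * M) := min_le_right _ _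
    calc δ * M ≤ ε / (2 * M) * M := mul_le_mul_of_nonneg_right this hM0.le
      _ = ε / 2 := by field_simp
  obtain ⟨s, hs1, hs2⟩ := exists_schwartz_graph_approx hE f hδ0
  have hy0 : ⟪(s.toLp 2 (stdGaussian E) : Lp ℝ 2 (stdGaussian E)),
      linearizedHardSpherePMap hE ((⟨s.toLp 2 (stdGaussian E), schwartz_toLp_mem_linearizedDomain s⟩ :
        linearizedDomain (E := E)))⟫_ℝ ≤ 0 := by
    rw [inner_linearizedHardSpherePMap_schwartz hE s]
    exact maxwellianInner_hardSphereLinearizedOp_self_nonpos_holds s.hasTemperateGrowth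
  -- abbreviations
  set x : Lp ℝ 2 (stdGaussian E) := (f : Lp ℝ 2 (stdGaussian E)) with hx
  set Ax : Lp ℝ 2 (stdGaussian E) := linearizedHardSpherePMap hE f with hAx
  set y : Lp ℝ 2 (stdGaussian E) := s.toLp 2 (stdGaussian E) with hy
  set Ay : Lp ℝ 2 (stdGaussian E) := linearizedHardSpherePMap hE
    ((⟨s.toLp 2 (stdGaussian E), schwartz_toLp_mem_linearizedDomain s⟩ : linearizedDomain (E := E)))
    with hAy
  have hyx : ‖y - x‖ < δ := hs1
  have hAyx : ‖Ay - Ax‖ < δ := hs2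
  have hynorm : ‖y‖ ≤ ‖x‖ + δ := by
    have := norm_le_insert' y x
    linarith
  -- `⟪x, Ax⟫ = ⟪y, Ay⟫ + ⟪x - y, Ax⟫ + ⟪y, Ax - Ay⟫`
  have hsplit : ⟪x, Ax⟫_ℝ = ⟪y, Ay⟫_ℝ + ⟪x - y, Ax⟫_ℝ + ⟪y, Ax - Ay⟫_ℝ := by
    rw [inner_sub_left, inner_sub_right]; ring
  have h1 : |⟪x - y, Ax⟫_ℝ| ≤ δ * ‖Ax‖ := by
    refine (abs_real_inner_le_norm _ _).trans ?_
    rw [norm_sub_rev]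
    exact mul_le_mul_of_nonneg_right hyx.le (norm_nonneg _)
  have h2 : |⟪y, Ax - Ay⟫_ℝ| ≤ (‖x‖ + δ) * δ := by
    refine (abs_real_inner_le_norm _ _).trans ?_
    rw [norm_sub_rev]
    exact mul_le_mul hynorm hAyx.le (norm_nonneg _) (by positivity)
  have h3 : δ * ‖Ax‖ + (‖x‖ + δ) * δ ≤ δ * M := by
    rw [hM]; nlinarith [norm_nonneg Ax, norm_nonneg x]
  calc ⟪x, Ax⟫_ℝ ≤ 0 + δ * ‖Ax‖ + (‖x‖ + δ) * δ := by
        rw [hsplit]; linarith [le_abs_self ⟪x - y, Ax⟫_ℝ, le_abs_self ⟪y, Ax - Ay⟫_ℝ]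
    _ ≤ ε / 2 := by linarith
    _ < 0 + ε := by linarith

/-- **`-A` is a positive (i.e. non-negative symmetric) operator**: the linearised hard-sphere
operator is non-positive (CIP 1994 §7.2 Thm 7.2.1 "self-adjoint and nonpositive"; `IsPositive` of
`Literature/Analysis/UnboundedOperators/SymmetricPMap`). [cite: CIPDiluteGases1994, §7.2 Thm 7.2.1] -/
theorem isPositive_neg_linearizedHardSpherePMap (hE : 2 ≤ finrank ℝ E) :
    (-linearizedHardSpherePMap hE).IsPositive := by
  refine ⟨fun f g => ?_, fun f => ?_⟩
  · rw [LinearPMap.neg_apply, LinearPMap.neg_apply, inner_neg_left, inner_neg_right,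
      inner_linearizedHardSpherePMap_comm]
  · rw [LinearPMap.neg_apply, inner_neg_right, RCLike.re_to_real, neg_nonneg]
    exact inner_linearizedHardSpherePMap_self_nonpos hE f

end Positivity

end

end Literature.Analysis.UnboundedOperators
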